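import Literature.AlgebraicGeometry.Motives.AbelianVarietyRationalCurvesProofs
import Literature.NumberTheory.DiophantineGeometry.AVKernelHopf
import Mathlib.AlgebraicGeometry.SpreadingOut
import Mathlib.AlgebraicGeometry.FunctionField
import HarnessLib

/-!
# `A(k(t)) = A(k)`: points of an abelian variety over a rational function field are constant
# (Milne, *Abelian Varieties*, Thm. 3.1 and Cor. 3.8)

J. S. Milne, *Abelian Varieties* (Ch. V of Cornell–Silverman, *Arithmetic Geometry*, 1986), §3,
Cor. 3.8: "Every rational map `ℙ¹ ⇢ A` [to an abelian variety] is constant" (with Thm. 3.1: a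
rational map from a smooth variety to an abelian variety is a morphism). This file PROVES the
field-valued-point form used in specialisation arguments (Lang, *Abelian Varieties*, II §2, proof
of Thm. 10: "`T(u)` is rational over `K(u)` … it is constant"): for an abelian variety `A` over a
field `k` and a field `K ⊇ k` which is a field of fractions of `k[y]` (a rational function field in
one variable over `k`), **every `K`-valued point of `A` over `k` is the constant point at a
`k`-rational point of `A`**:

* `AbelianVariety.fromSpecStalk_genericPoint_const` — a `k`-morphism `Spec K(𝔸¹) → A` from the
  generic point of `𝔸¹ = Spec k[y]` factors through a `k`-point `P₀ : Spec k → A`: spread it out to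
  an open `U ∋ ξ` of `𝔸¹` (Mathlib `spread_out_of_isGermInjective'`, Stacks 0BX6), extend it to `𝔸¹`
  (Thm. 3.1, the tree's `AbelianVariety.exists_extension_specMap`), and a morphism `𝔸¹ → A` is
  constant (Cor. 3.8, the tree's `AbelianVariety.specMap_affineLine_const`); `P₀` is a `k`-point
  because `𝔸¹ → Spec k` has the section `y ↦ 0`;
* `AbelianVariety.algPoints_const_of_isFractionRing` — **`A(K) = A(k)`** for `K` with
  `IsFractionRing k[y] K` (transport along `K ≅ K(𝔸¹)`, Mathlib `IsLocalization.algEquiv` and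
  `functionField_isFractionRing_of_affine`): `x = Spec(k → K) ≫ P₀` in `AlgPoints A.X`;
* `AbelianVariety.algPoints_const_of_algEquiv` — the same along any `k`-isomorphism
  `Frac k[y] ≃ₐ[k] K` (the form fed by Mathlib's `AlgebraicIndependent.aevalEquivField` for
  `K = k(r)`, `r` transcendental).

Everything is proved; no definitions besides the abbreviation `affineLine`, no named facts (D-0026).

Mathlib searched (pin): `spread_out_of_isGermInjective'`, `Scheme.Opens.fromSpecStalkOfMem_ι`,
`Spec.fromSpecStalk_eq'`, `functionField_isFractionRing_of_affine`, `IsLocalization.algEquiv`,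
`MvPolynomial.aeval`, `AlgHom.comp_algebraMap` (all used).

## References

* J. S. Milne, *Abelian Varieties*, in G. Cornell, J. H. Silverman (eds.), *Arithmetic Geometry*,
  Springer 1986, Ch. V, §3 Thm. 3.1, Cor. 3.8. [Milne1986AbelianVarieties]
* S. Lang, *Abelian Varieties* (1959/1983), II §2, proof of Thm. 10. [Lang1983AbelianVarieties]
* The Stacks Project, Tag 0BX6 (spreading out). [StacksProject]
-/

noncomputable section

universe u

open CategoryTheory AlgebraicGeometry MvPolynomial

namespace Literature.AlgebraicGeometry.Motives

open AbelianVarietyRationalCurves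

variable {k : Type u} [Field k]

/-- The affine line `𝔸¹ = Spec k[y]`. [folklore] -/
abbrev affineLine (k : Type u) [Field k] : Scheme.{u} := Spec (.of (R₁ k))

/-- **A rational map `𝔸¹ ⇢ A` is constant**: a `k`-morphism from the generic point
`Spec K(𝔸¹) → A` of the affine line to an abelian variety factors through a `k`-point of `A`.
Spread it out to an open `U ∋ ξ` (Mathlib `spread_out_of_isGermInjective'`, Stacks 0BX6), extend to
`𝔸¹ → A` (Milne, *Abelian Varieties*, Thm. 3.1, the tree's `AbelianVariety.exists_extension_specMap`)
and use that `𝔸¹ → A` is constant (Milne Cor. 3.8, the tree's `AbelianVariety.specMap_affineLine_const`).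
[cite: Milne1986AbelianVarieties, §3 Thm. 3.1 and Cor. 3.8] -/
theorem AbelianVariety.fromSpecStalk_genericPoint_const (A : AbelianVariety k)
    (φ : Spec ((affineLine k).presheaf.stalk (genericPoint (affineLine k))) ⟶ A.X.left)
    (hφ : φ ≫ A.X.hom = (affineLine k).fromSpecStalk _ ≫
      Spec.map (CommRingCat.ofHom (algebraMap k (R₁ k)))) :
    ∃ P₀ : Spec (.of k) ⟶ A.X.left, P₀ ≫ A.X.hom = 𝟙 _ ∧
      φ = ((affineLine k).fromSpecStalk _ ≫ Spec.map (CommRingCat.ofHom (algebraMap k (R₁ k)))) ≫ P₀ := by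
  obtain ⟨U, hxU, f, hφf, hf⟩ := spread_out_of_isGermInjective'
    (Spec.map (CommRingCat.ofHom (algebraMap k (R₁ k)))) A.X.hom φ hφ
  haveI : Nonempty (U : Scheme.{u}) := ⟨⟨_, hxU⟩⟩
  haveI := smooth_specOver_mvPolynomial (k := k) 1
  haveI := geometricallyIntegral_specOver_mvPolynomial (k := k) 1
  obtain ⟨H, hH, hjH⟩ := A.exists_extension_specMap (R := R₁ k) U.ι f hf
  obtain ⟨P₀, hP₀⟩ := A.specMap_affineLine_const H hH
  refine ⟨P₀, ?_, ?_⟩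
  · -- `P₀` lies over `Spec k`: test against the section `y ↦ 0` of `𝔸¹ → Spec k`
    set sec : Spec (.of k) ⟶ affineLine k :=
      Spec.map (CommRingCat.ofHom (MvPolynomial.aeval (fun _ : Fin 1 => (0 : k))).toRingHom) with hsec
    have hsec1 : sec ≫ Spec.map (CommRingCat.ofHom (algebraMap k (R₁ k))) = 𝟙 _ := by
      rw [hsec, ← Spec.map_comp, ← CommRingCat.ofHom_comp]
      have : (MvPolynomial.aeval (fun _ : Fin 1 => (0 : k))).toRingHom.comp (algebraMap k (R₁ k)) =
          RingHom.id k := (MvPolynomial.aeval (fun _ : Fin 1 => (0 : k))).comp_algebraMap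
      rw [this, CommRingCat.ofHom_id, Spec.map_id]
    calc P₀ ≫ A.X.hom = (sec ≫ Spec.map (CommRingCat.ofHom (algebraMap k (R₁ k)))) ≫ P₀ ≫ A.X.hom := by
          rw [hsec1, Category.id_comp]
      _ = sec ≫ H ≫ A.X.hom := by rw [hP₀, Category.assoc, Category.assoc]
      _ = 𝟙 _ := by rw [hH, hsec1]
  · rw [hφf, ← hjH, hP₀, ← Category.assoc, ← Category.assoc, Scheme.Opens.fromSpecStalkOfMem_ι]

/-- **`A(K) = A(k)` for a rational function field `K = Frac k[y]`**: every `K`-valued point of an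
abelian variety `A / k` over a field of fractions `K` of `k[y]` is the constant point at a `k`-point
of `A` (Milne, *Abelian Varieties*, Cor. 3.8: "every rational map `ℙ¹ ⇢ A` is constant").
[cite: Milne1986AbelianVarieties, §3 Thm. 3.1 and Cor. 3.8] -/
theorem AbelianVariety.algPoints_const_of_isFractionRing (A : AbelianVariety k)
    (K : Type u) [Field K] [Algebra k K] [Algebra (R₁ k) K] [IsScalarTower k (R₁ k) K]
    [IsFractionRing (R₁ k) K] (x : AlgPoints A.X K) :
    ∃ P₀ : AlgPoints A.X k, x = AlgPoints.specOverMapOfAlgHom (Algebra.ofId k K) ≫ P₀ := by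
  let F : Type u := ((affineLine k).functionField : Type u)
  letI algF : Algebra (R₁ k) F := AlgebraicGeometry.instAlgebraCarrierFunctionFieldSpec (.of (R₁ k))
  haveI : IsFractionRing (R₁ k) F :=
    AlgebraicGeometry.functionField_isFractionRing_of_affine (.of (R₁ k))
  letI algkF : Algebra k F := ((algebraMap (R₁ k) F).comp (algebraMap k (R₁ k))).toAlgebra
  haveI : IsScalarTower k (R₁ k) F := IsScalarTower.of_algebraMap_eq fun c => rfl
  have hfs : (affineLine k).fromSpecStalk (genericPoint (affineLine k)) =
      Spec.map (CommRingCat.ofHom (algebraMap (R₁ k) F)) := by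
    rw [Spec.fromSpecStalk_eq']; rfl
  -- `K ≅ K(𝔸¹)` over `k[y]`, hence over `k`
  let e : K ≃ₐ[R₁ k] F := IsLocalization.algEquiv (nonZeroDivisors (R₁ k)) K F
  let eK : K →ₐ[k] F := (e : K →ₐ[R₁ k] F).restrictScalars k
  let eK' : F →ₐ[k] K := (e.symm : F →ₐ[R₁ k] K).restrictScalars k
  -- the given point, moved to the generic point of `𝔸¹`
  set φ' : specOver k F ⟶ A.X := AlgPoints.specOverMapOfAlgHom eK ≫ x with hφ'def
  have hφ : φ'.left ≫ A.X.hom = (affineLine k).fromSpecStalk _ ≫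
      Spec.map (CommRingCat.ofHom (algebraMap k (R₁ k))) := by
    rw [Over.w φ', hfs, ← Spec.map_comp, ← CommRingCat.ofHom_comp]
    rfl
  obtain ⟨P₀, hP₀w, hP₀⟩ := A.fromSpecStalk_genericPoint_const φ'.left hφ
  have hP₀w' : P₀ ≫ A.X.hom = (specOver k k).hom := by
    rw [hP₀w]
    change 𝟙 _ = Spec.map (CommRingCat.ofHom (algebraMap k k))
    rw [Algebra.algebraMap_self, CommRingCat.ofHom_id, Spec.map_id]
  refine ⟨Over.homMk P₀ hP₀w', ?_⟩
  -- `Spec` of `k`-algebra maps, functoriality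
  have hcomp : ∀ {R R' R'' : Type u} [CommRing R] [Algebra k R] [CommRing R'] [Algebra k R']
      [CommRing R''] [Algebra k R''] (ψ₁ : R →ₐ[k] R') (ψ₂ : R' →ₐ[k] R''),
      AlgPoints.specOverMapOfAlgHom ψ₂ ≫ AlgPoints.specOverMapOfAlgHom ψ₁ =
        AlgPoints.specOverMapOfAlgHom (ψ₂.comp ψ₁) := by
    intro R R' R'' _ _ _ _ _ _ ψ₁ ψ₂
    apply Over.OverMorphism.ext
    rw [Over.comp_left, AlgPoints.specOverMapOfAlgHom_left, AlgPoints.specOverMapOfAlgHom_left,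
      AlgPoints.specOverMapOfAlgHom_left]
    exact (Spec.map_comp (CommRingCat.ofHom ψ₁.toRingHom) (CommRingCat.ofHom ψ₂.toRingHom)).symm
  have hid : AlgPoints.specOverMapOfAlgHom (AlgHom.id k K) = 𝟙 _ := by
    apply Over.OverMorphism.ext
    rw [AlgPoints.specOverMapOfAlgHom_left, Over.id_left]
    exact Spec.map_id _
  -- `x = Spec(e⁻¹) ≫ φ'`
  have h1 : x = AlgPoints.specOverMapOfAlgHom eK' ≫ φ' := by
    rw [hφ'def, ← Category.assoc, hcomp]
    have : eK'.comp eK = AlgHom.id k K := by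
      ext y; exact e.symm_apply_apply y
    rw [this, hid, Category.id_comp]
  -- `φ'` is the constant point `P₀`
  have hφ'eq : φ' = AlgPoints.specOverMapOfAlgHom (Algebra.ofId k F) ≫ Over.homMk P₀ hP₀w' := by
    apply Over.OverMorphism.ext
    rw [hP₀, hfs]
    change (Spec.map (CommRingCat.ofHom (algebraMap (R₁ k) F)) ≫
        Spec.map (CommRingCat.ofHom (algebraMap k (R₁ k)))) ≫ P₀ =
      Spec.map (CommRingCat.ofHom (algebraMap k F)) ≫ P₀
    rw [← Spec.map_comp, ← CommRingCat.ofHom_comp]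
  have hψ : eK'.comp (Algebra.ofId k F) = Algebra.ofId k K := Subsingleton.elim _ _
  rw [h1, hφ'eq, ← Category.assoc, hcomp, hψ]

/-- **`A(K) = A(k)` along an identification `K ≅ Frac k[y]`** (transport of
`algPoints_const_of_isFractionRing`; this is the form used for `K = k(r) ⊆ k(C)`, `r`
transcendental, via Mathlib's `AlgebraicIndependent.aevalEquivField`).
[cite: Milne1986AbelianVarieties, §3 Cor. 3.8] -/
theorem AbelianVariety.algPoints_const_of_algEquiv (A : AbelianVariety k)
    {K : Type u} [Field K] [Algebra k K] (e : FractionRing (R₁ k) ≃ₐ[k] K) (x : AlgPoints A.X K) :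
    ∃ P₀ : AlgPoints A.X k, x = AlgPoints.specOverMapOfAlgHom (Algebra.ofId k K) ≫ P₀ := by
  set x' : AlgPoints A.X (FractionRing (R₁ k)) :=
    AlgPoints.specOverMapOfAlgHom (e.symm : K →ₐ[k] FractionRing (R₁ k)) ≫ x with hx'
  obtain ⟨P₀, hP₀⟩ := A.algPoints_const_of_isFractionRing (FractionRing (R₁ k)) x'
  refine ⟨P₀, ?_⟩
  have hcomp : ∀ {R R' R'' : Type u} [CommRing R] [Algebra k R] [CommRing R'] [Algebra k R']
      [CommRing R''] [Algebra k R''] (ψ₁ : R →ₐ[k] R') (ψ₂ : R' →ₐ[k] R''),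
      AlgPoints.specOverMapOfAlgHom ψ₂ ≫ AlgPoints.specOverMapOfAlgHom ψ₁ =
        AlgPoints.specOverMapOfAlgHom (ψ₂.comp ψ₁) := by
    intro R R' R'' _ _ _ _ _ _ ψ₁ ψ₂
    apply Over.OverMorphism.ext
    rw [Over.comp_left, AlgPoints.specOverMapOfAlgHom_left, AlgPoints.specOverMapOfAlgHom_left,
      AlgPoints.specOverMapOfAlgHom_left]
    exact (Spec.map_comp (CommRingCat.ofHom ψ₁.toRingHom) (CommRingCat.ofHom ψ₂.toRingHom)).symm
  have hid : AlgPoints.specOverMapOfAlgHom (AlgHom.id k K) = 𝟙 _ := by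
    apply Over.OverMorphism.ext
    rw [AlgPoints.specOverMapOfAlgHom_left, Over.id_left]
    exact Spec.map_id _
  have h1 : x = AlgPoints.specOverMapOfAlgHom (e : FractionRing (R₁ k) →ₐ[k] K) ≫ x' := by
    rw [hx', ← Category.assoc, hcomp]
    have : (e : FractionRing (R₁ k) →ₐ[k] K).comp (e.symm : K →ₐ[k] FractionRing (R₁ k)) =
        AlgHom.id k K := by
      ext y; exact e.apply_symm_apply y
    rw [this, hid, Category.id_comp]
  have hψ : (e : FractionRing (R₁ k) →ₐ[k] K).comp (Algebra.ofId k (FractionRing (R₁ k))) =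
      Algebra.ofId k K := Subsingleton.elim _ _
  rw [h1, hP₀, ← Category.assoc, hcomp, hψ]

end Literature.AlgebraicGeometry.Motives
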